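import Summits.BirchSwinnertonDyer.BirchSwinnertonDyer.Theorems.SignedLowerHalvesSmallImageMuZeroOneSignFinePivotConverse
import Summits.BirchSwinnertonDyer.BirchSwinnertonDyer.Theorems.SignedLowerHalvesSmallImageMuZeroOneSignClassNumberDoor
import Literature.NumberTheory.EllipticCurves.FineSelmerDivisionSubfieldMuRoad
import HarnessLib

/-!
# Crux M `SmallImageMuZeroOneSign` (item stmt-BirchSwinnertonDyer-23600) — NEGATIVE lemmas: what is load-bearing in M, and the
# price of a counterexample (Conjecture A fails · a non-zero `χ_P`-eigenline in `Cl(ℚ(P))/p` · Iwasawa's `μ = 0` conjecture fails)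

Standing disprover `cdisprove-stmt-BirchSwinnertonDyer-23600` (g0), cell `bsd-ssimc`, route `SignedLowerHalves` (K3); `--supports
stmt-BirchSwinnertonDyer-23600` (negative lane).  HONEST FRAMING: THEOREMS ONLY (no definition, no named fact, no instance, no
`sorry`); every conditional theorem displays its printed binders (`h12` = Kobayashi Thm. 1.2; `hKP hKo` = the two Kurihara–Pollack
sentences; `hMa` = Matar Thm. 1.1) and discharges none.  **No kill**: no pair with `μ(X⁺) > 0 ∧ μ(X⁻) > 0` is known; crux M,
Conjecture A and BSD are proved for NO curve here; nothing is booked.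

M's body at a pair `(W, p)` ("one-sign `μ = 0`") is written out verbatim below as
`∃ ε, ∀ κ γ, κ.IsCyclotomic → κ.IsTopGenerator γ → IsCyclotomicVariable p γ → ∀ D ξ, D.charIdeal = (ξ) → μ(ξ) = 0`.

* §1 LOAD-BEARING ANALYSIS.  `oneSignMuZero_false_without_charIdeal` — with the binder `D.charIdeal = (ξ)` dropped the body is FALSE at
  EVERY pair, unconditionally (`ξ = p`, `μ(p) = 1`; frames and dual data exist); `not_forall_ne_zero_mu_eq_zero` — the algebraic
  strengthening "every non-zero `ξ ∈ Λ` has `μ = 0`" is false; `oneSignMuZero_iff_exists_datum` / `oneSignMuZero_iff_sansCycVar` —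
  modulo Kobayashi Thm. 1.2 the binder `IsCyclotomicVariable p γ` is REDUNDANT and the inner `∀ κ γ D ξ` collapses to `∃` (one torsion
  datum with `μ = 0` decides the pair: `μ^ε = 0` is frame-independent, `SignedSelmerDualData.mu_eq_zero_of_mu_eq_zero_of_isCyclotomic`).
* §2 PRICE OF A COUNTEREXAMPLE (necessary conditions at a domain pair where the body FAILS, i.e. both signs have `μ > 0`):
  (N0) `not_conjAAt_of_not_oneSignMuZero` — Conjecture A fails (mod `hKP hKo hMa`; contrapositive of LEAD gen 2's lever);
  (N2) `conjAAt_of_eigenHom_stabilizerField` (FACT-FREE door: Conjecture A from the eigen-test of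
  `CoatesSujatha2005.conjA_of_eigenHom_subfield` at `K = ℚ(P)`, (c1) by Serre's Prop. 15, (c3) by `cleanAtP_of_goodSS`) and its
  contrapositive `exists_eigenHom_ne_zero_of_not_oneSignMuZero` — for EVERY `P ≠ 0` a NON-ZERO `χ_P`-eigen additive map
  `Cl(𝓞_{ℚ(P)}) → ℤ/p` exists (sharper than LEAD's `p ∣ h(ℚ(P))`, `SmallImageCleanAtP.dvd_classNumber_stabilizerField_of_not_oneSignMuZero`);
  (N3) `exists_not_classicalMuVanishes_of_not_oneSignMuZero` — for every `σ` fixing a non-zero `P`, the cyclotomic `ℤ_p`-extension of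
  `ℚ(E[p])^{⟨σ̄⟩}` has POSITIVE classical `μ` (conjA-anchor's `conjA_rat_of_exists_classicalMuVanishes_fixedField_zpowers`): `σ = 1` gives
  `ℚ(E[p])`, `σ̄` generating `Stab(P)` gives `ℚ(P)` (degree `p² − 1`); `not_smallImageMuZeroOneSign_imp_iwasawaMu_fails` — **`¬M` implies
  that IWASAWA's `μ = 0` CONJECTURE FAILS for some number field** (mod `hKP hKo hMa`).
READING FOR THE PEN (numbers): the census currency for a disprover is therefore, per row, (i) `p ∣ h(ℚ(P))` [LEAD], (ii) the `χ_P`-eigenline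
of `Cl(ℚ(P))/p` non-zero [this file], (iii) `μ(ℚ(P)_cyc) > 0` [this file] — (iii) contradicts Iwasawa's conjecture, so no row is expected
to survive; a kill of M is not expected to exist.

References: [Kobayashi2003] Thm. 1.2, Def. 1.1, p. 35; [CoatesSujatha2005] §3 Conjecture A, Thm. 3.4, Lemma 3.8; [DeoRaySujatha2023] §3
Thm. 3.8–3.9, §5 Lemma 5.1; [KuriharaPollack2007] §1.2, §3 p. 328; [Matar2020] Thm. 1.1; [Serre1972] §2.4 Prop. 15; [Iwasawa1973] §1;
[Washington1997] §13.1–13.2; [GreenbergVatsal2000] (1)–(2).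
-/

set_option autoImplicit false
set_option linter.dupNamespace false

noncomputable section

open scoped Classical NumberField nonZeroDivisors

open IsDedekindDomain Field NumberField WeierstrassCurve IntermediateField Literature.NumberTheory.GaloisRepresentations
  Literature.NumberTheory.NumberFields
open Literature.NumberTheory.EllipticCurves Literature.NumberTheory.EllipticCurves.Module
  Literature.NumberTheory.EllipticCurves.IwasawaAlgebra
open Literature.NumberTheory.EllipticCurves.Kobayashi2003 Literature.NumberTheory.EllipticCurves.Rank1Residual
  Literature.NumberTheory.EllipticCurves.ZpExtension Literature.NumberTheory.IwasawaTheory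
  Summit.BirchSwinnertonDyer.Rank1Residual.X1.MuLambda
  Summit.BirchSwinnertonDyer.BirchSwinnertonDyer.Theorems

namespace Summit.BirchSwinnertonDyer.BirchSwinnertonDyer.Theorems.SmallImageMuZeroOneSignNegative

/-! ## §1 Load-bearing analysis -/

section LoadBearing

variable {p : ℕ} [hpP : Fact p.Prime]

/-- `μ(p) ≥ 1` in `Λ = ℤ_p⟦T⟧`. [cite: GreenbergVatsal2000, p. 2, (2)] -/
theorem one_le_mu_C_p : 1 ≤ mu (PowerSeries.C ((p : ℤ_[p]) ^ 1) : IwasawaAlgebra p) :=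
  le_mu_of_C_pow_dvd (C_pow_ne_zero (p := p) 1) (dvd_refl _)

/-- **The binder `D.charIdeal = (ξ)` of crux M is LOAD-BEARING — at EVERY pair `(W, p)`, unconditionally**: with it dropped, M's body
says that every `ξ ∈ Λ` has `μ(ξ) = 0` over some existing frame and datum, and `ξ = p` has `μ = 1` (a normalised cyclotomic frame
exists, `exists_isCyclotomic_isTopGenerator_isCyclotomicVariable_holds`; a dual datum exists, `nonempty_signedSelmerDualData`).
"Any proof of M must use the characteristic ideal." [cite: Kobayashi2003, Def. 1.1 (existence of the dual)] [cite: Washington1997, §13.1] -/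
theorem oneSignMuZero_false_without_charIdeal (W : WeierstrassCurve ℚ) [W.IsElliptic] [W.IsGloballyMinimal] :
    ¬ ∃ ε : ℤˣ, ∀ (κ : ZpExtension ℚ p) (γ : absoluteGaloisGroup ℚ), κ.IsCyclotomic → κ.IsTopGenerator γ →
      IsCyclotomicVariable p γ → SignedSelmerDualData W κ γ ε → ∀ ξ : IwasawaAlgebra p, mu ξ = 0 := by
  rintro ⟨ε, h⟩
  obtain ⟨κ, hκ, γ, hγ, hγ'⟩ := exists_isCyclotomic_isTopGenerator_isCyclotomicVariable_holds p
  obtain ⟨D⟩ := nonempty_signedSelmerDualData W κ ε hγ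
  have h1 := h κ γ hκ hγ hγ' D (PowerSeries.C ((p : ℤ_[p]) ^ 1))
  have h2 := one_le_mu_C_p (p := p)
  omega

/-- **The algebraic strengthening is FALSE**: not every non-zero `ξ ∈ Λ` has `μ(ξ) = 0` (`ξ = p`) — M is a statement about WHICH
principal ideals occur as `char X^ε`, not commutative algebra. [cite: GreenbergVatsal2000, p. 2, (2)] -/
theorem not_forall_ne_zero_mu_eq_zero : ¬ ∀ ξ : IwasawaAlgebra p, ξ ≠ 0 → mu ξ = 0 := by
  intro h
  have h1 := h _ (C_pow_ne_zero (p := p) 1)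
  have h2 := one_le_mu_C_p (p := p)
  omega

/-- The characteristic ideal of any `Λ`-module is non-zero (a finite product of powers of height-one primes of a domain).
[cite: Washington1997, §13.2] -/
theorem charIdeal_ne_bot (M : Type*) [AddCommGroup M] [Module (IwasawaAlgebra p) M] :
    charIdeal (IwasawaAlgebra p) M ≠ ⊥ := by
  unfold charIdeal
  refine finprod_mem_induction (fun I : Ideal (IwasawaAlgebra p) ↦ I ≠ ⊥) ?_ (fun I J hI hJ ↦ ?_) ?_
  · rw [Ideal.one_eq_top]
    exact top_ne_bot
  · exact fun h ↦ (Ideal.mul_eq_bot.mp h).elim hI hJ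
  · intro 𝔭 h𝔭 h
    have h1 : 𝔭.asIdeal ≠ ⊥ := Ideal.ne_bot_of_height_eq_one h𝔭
    rcases Nat.eq_zero_or_pos (lengthAt (IwasawaAlgebra p) M 𝔭).toNat with h0 | hpos
    · rw [h0, pow_zero, Ideal.one_eq_top] at h
      exact top_ne_bot h
    · exact h1 ((Ideal.pow_eq_bot hpos.ne').mp h)

/-- A generator of the characteristic ideal of a dual datum is non-zero. [cite: Washington1997, §13.2] -/
theorem generator_ne_zero {W : WeierstrassCurve ℚ} [W.IsElliptic] {κ : ZpExtension ℚ p} {γ : absoluteGaloisGroup ℚ}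
    {ε : ℤˣ} (D : SignedSelmerDualData W κ γ ε) {ξ : IwasawaAlgebra p} (hξ : D.charIdeal = Ideal.span {ξ}) : ξ ≠ 0 := by
  intro h0
  apply charIdeal_ne_bot (p := p) D.X
  rw [show charIdeal (IwasawaAlgebra p) D.X = Ideal.span {ξ} from hξ, h0, Ideal.span_singleton_eq_bot]

/-- For a finitely generated torsion dual datum, `μ(ξ) = 0` for a generator `ξ` of `char X^ε` iff `μ(X^ε) = 0` (`D.mu`).
[cite: Washington1997, §13.2] [cite: GreenbergVatsal2000, p. 2, (1)–(2)] -/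
theorem mu_generator_eq_zero_iff {W : WeierstrassCurve ℚ} [W.IsElliptic] {κ : ZpExtension ℚ p} {γ : absoluteGaloisGroup ℚ}
    {ε : ℤˣ} (D : SignedSelmerDualData W κ γ ε) [Module.Finite (IwasawaAlgebra p) D.X]
    (hDt : Module.IsTorsion (IwasawaAlgebra p) D.X) {ξ : IwasawaAlgebra p} (hξ : D.charIdeal = Ideal.span {ξ}) :
    mu ξ = 0 ↔ D.mu = 0 := by
  rw [Summit.BirchSwinnertonDyer.Rank1Residual.X1.MuPart.mu_generator_eq_muInvariant D.X hDt (generator_ne_zero D hξ) hξ]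
  rfl

/-- **`IsCyclotomicVariable p γ` is NOT load-bearing and the `∀ κ γ D ξ` of M's body collapses to `∃`** (modulo Kobayashi Thm. 1.2):
at a good supersingular odd `p` with `a_p = 0`, M's body at the pair is equivalent to «for some sign `ε`, SOME dual datum over SOME
cyclotomic frame (no normalisation of `γ`) has `μ = 0`» — `μ^ε = 0` does not depend on the cyclotomic pair
(`SignedSelmerDualData.mu_eq_zero_of_mu_eq_zero_of_isCyclotomic`), every datum is f.g. torsion (Thm. 1.2) with principal characteristic
ideal (`charIdeal_isPrincipal_holds`).  Information for the planner: the two inner binders are decoration.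
[cite: Kobayashi2003, Thm. 1.2, Thm. 1.4 (the invariants only)] [cite: Washington1997, §13.1–13.2] [cite: GreenbergLNM1716, §1 p. 60] -/
theorem oneSignMuZero_iff_exists_datum (h12 : thm12_signedSelmerDual_finite_torsion)
    (W : WeierstrassCurve ℚ) [W.IsElliptic] [W.IsGloballyMinimal] (hp : p ≠ 2)
    (hgood : W.HasGoodReductionAtPrime p) (hap : W.frobeniusTrace p = 0) :
    (∃ ε : ℤˣ, ∀ (κ : ZpExtension ℚ p) (γ : absoluteGaloisGroup ℚ), κ.IsCyclotomic → κ.IsTopGenerator γ →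
      IsCyclotomicVariable p γ → ∀ (D : SignedSelmerDualData W κ γ ε) (ξ : IwasawaAlgebra p),
        D.charIdeal = Ideal.span {ξ} → mu ξ = 0) ↔
      ∃ (ε : ℤˣ) (κ : ZpExtension ℚ p) (γ : absoluteGaloisGroup ℚ) (_ : κ.IsCyclotomic) (_ : κ.IsTopGenerator γ)
        (D : SignedSelmerDualData W κ γ ε), D.mu = 0 := by
  constructor
  · rintro ⟨ε, h⟩
    obtain ⟨κ, hκ, γ, hγ, hγ'⟩ := exists_isCyclotomic_isTopGenerator_isCyclotomicVariable_holds p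
    obtain ⟨D⟩ := nonempty_signedSelmerDualData W κ ε hγ
    obtain ⟨hDf, hDt⟩ := h12 W p hp hgood hap κ γ hκ hγ ε D
    haveI := hDf
    obtain ⟨ξ, hξ⟩ := (charIdeal_isPrincipal_holds p D.X).principal
    have hξ' : D.charIdeal = Ideal.span {ξ} := hξ
    exact ⟨ε, κ, γ, hκ, hγ, D, (mu_generator_eq_zero_iff D hDt hξ').mp (h κ γ hκ hγ hγ' D ξ hξ')⟩
  · rintro ⟨ε, κ₀, γ₀, hκ₀, hγ₀, D₀, hμ₀⟩
    refine ⟨ε, fun κ γ hκ hγ _ D ξ hξ ↦ ?_⟩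
    obtain ⟨hD₀f, hD₀t⟩ := h12 W p hp hgood hap κ₀ γ₀ hκ₀ hγ₀ ε D₀
    obtain ⟨hDf, hDt⟩ := h12 W p hp hgood hap κ γ hκ hγ ε D
    haveI := hDf
    exact (mu_generator_eq_zero_iff D hDt hξ).mpr
      (SignedSelmerDualData.mu_eq_zero_of_mu_eq_zero_of_isCyclotomic hκ₀ hκ hγ₀ hγ D₀ D hD₀t hμ₀)

/-- **Corollary: dropping `IsCyclotomicVariable p γ` does not change M's body** (mod Thm. 1.2). [cite: Kobayashi2003, Thm. 1.2]
[cite: Washington1997, §13.1–13.2] -/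
theorem oneSignMuZero_iff_sansCycVar (h12 : thm12_signedSelmerDual_finite_torsion)
    (W : WeierstrassCurve ℚ) [W.IsElliptic] [W.IsGloballyMinimal] (hp : p ≠ 2)
    (hgood : W.HasGoodReductionAtPrime p) (hap : W.frobeniusTrace p = 0) :
    (∃ ε : ℤˣ, ∀ (κ : ZpExtension ℚ p) (γ : absoluteGaloisGroup ℚ), κ.IsCyclotomic → κ.IsTopGenerator γ →
      IsCyclotomicVariable p γ → ∀ (D : SignedSelmerDualData W κ γ ε) (ξ : IwasawaAlgebra p),
        D.charIdeal = Ideal.span {ξ} → mu ξ = 0) ↔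
      ∃ ε : ℤˣ, ∀ (κ : ZpExtension ℚ p) (γ : absoluteGaloisGroup ℚ), κ.IsCyclotomic → κ.IsTopGenerator γ →
        ∀ (D : SignedSelmerDualData W κ γ ε) (ξ : IwasawaAlgebra p), D.charIdeal = Ideal.span {ξ} → mu ξ = 0 := by
  constructor
  · intro h
    obtain ⟨ε, κ₀, γ₀, hκ₀, hγ₀, D₀, hμ₀⟩ := (oneSignMuZero_iff_exists_datum h12 W hp hgood hap).mp h
    refine ⟨ε, fun κ γ hκ hγ D ξ hξ ↦ ?_⟩
    obtain ⟨hD₀f, hD₀t⟩ := h12 W p hp hgood hap κ₀ γ₀ hκ₀ hγ₀ ε D₀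
    obtain ⟨hDf, hDt⟩ := h12 W p hp hgood hap κ γ hκ hγ ε D
    haveI := hDf
    exact (mu_generator_eq_zero_iff D hDt hξ).mpr
      (SignedSelmerDualData.mu_eq_zero_of_mu_eq_zero_of_isCyclotomic hκ₀ hκ hγ₀ hγ D₀ D hD₀t hμ₀)
  · rintro ⟨ε, h⟩
    exact ⟨ε, fun κ γ hκ hγ _ D ξ hξ ↦ h κ γ hκ hγ D ξ hξ⟩

end LoadBearing

/-! ## §2 The price of a counterexample -/

section Price

variable {p : ℕ} [hpP : Fact p.Prime]

/-- **(N0) A failing pair violates Conjecture A** (mod the three prints of the fine-pivot lever): contrapositive of LEAD gen 2's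
`SmallImageFinePivot.oneSignMuZero_of_conjAAt`. [cite: CoatesSujatha2005, §3 Conjecture A] [cite: KuriharaPollack2007, §1.2, §3 p. 328]
[cite: Matar2020, Thm. 1.1] -/
theorem not_conjAAt_of_not_oneSignMuZero
    (hKP : kuriharaPollack2007_selmerDual_extension_of_fineDual) (hKo : signedSelmerInf_sub_fineSelmer_of_loc)
    (hMa : matar2020_thm11_selmerDualTorsion_pseudoIso_fineSelmerDual)
    (W : WeierstrassCurve ℚ) [W.IsElliptic] [W.IsGloballyMinimal] (hp : p ≠ 2)
    (hgood : W.HasGoodReductionAtPrime p) (hap : W.frobeniusTrace p = 0)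
    (hM : ¬ ∃ ε : ℤˣ, ∀ (κ : ZpExtension ℚ p) (γ : absoluteGaloisGroup ℚ), κ.IsCyclotomic → κ.IsTopGenerator γ →
      IsCyclotomicVariable p γ → ∀ (D : SignedSelmerDualData W κ γ ε) (ξ : IwasawaAlgebra p),
        D.charIdeal = Ideal.span {ξ} → mu ξ = 0) :
    ¬ ConjAAt W p :=
  fun hA ↦ hM (SmallImageFinePivot.oneSignMuZero_of_conjAAt hKP hKo hMa W hp hgood hap hA)

/-- **Conjecture A at a domain pair from the EIGEN-TEST at `ℚ(P)`**, FACT-FREE: `CoatesSujatha2005.conjA_of_eigenHom_subfield` at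
`K = ℚ(P)` (the fixed field, inside `ℚ(E[p])`, of the image of `Stab_{Γ_ℚ}(P)`), with (c1) `p ∤ #Gal(ℚ(E[p])/ℚ)` by Serre's Prop. 15
(`SmallImageDickson.not_dvd_card_aut_divisionField`, `E[p]` irreducible on the domain) and (c3) by `cleanAtP_of_goodSS`.  The eigen
hypothesis: every additive `μ : Cl(𝓞_{ℚ(P)}) → ℤ/p` with `μ(σI) = a·μ(I)` whenever `σ = τ|_{ℚ(P)}` and `τP = aP` vanishes — on an
`N(C_ns)`-row `Aut(ℚ(P)/ℚ) ≅ 𝔽_pˣ` and this says the `χ_P`-eigenline of `Cl(ℚ(P))/p` is zero.  `¬ HasCM`, `a_p = 0` not needed.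
[cite: CoatesSujatha2005, §3 Thm. 3.4 and Lemma 3.8] [cite: DeoRaySujatha2023, §3 Thm. 3.8 (c2), Thm. 3.9 (b)] [cite: Serre1972, §2.4 Prop. 15] -/
theorem conjAAt_of_eigenHom_stabilizerField (W : WeierstrassCurve ℚ) [W.IsElliptic] [W.IsGloballyMinimal] [NeZero p]
    (hp2 : p ≠ 2) (h7 : ClassX7 W p) (hns : ¬ Surj W p) (P : geomTorsion W (p : ℤ)) (hP0 : P ≠ 0)
    (hEig : haveI : NumberField ↥(W.divisionField p) := NumberField.mk
      ∀ μ : Additive (ClassGroup (𝓞 ↥(fixedField ((MulAction.stabilizer (absoluteGaloisGroup ℚ) P).map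
          (absRestrictNormalHom (W.divisionField p)))))) →+ ZMod p,
        (∀ (τ : absoluteGaloisGroup ℚ)
            (σ : ↥(fixedField ((MulAction.stabilizer (absoluteGaloisGroup ℚ) P).map (absRestrictNormalHom (W.divisionField p))))
              ≃ₐ[ℚ] ↥(fixedField ((MulAction.stabilizer (absoluteGaloisGroup ℚ) P).map (absRestrictNormalHom (W.divisionField p)))))
            (a : ℕ),
          (∀ x : ↥(fixedField ((MulAction.stabilizer (absoluteGaloisGroup ℚ) P).map (absRestrictNormalHom (W.divisionField p)))),
              absRestrictNormalHom (W.divisionField p) τ (x : W.divisionField p) =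
                ((σ x : ↥(fixedField ((MulAction.stabilizer (absoluteGaloisGroup ℚ) P).map
                  (absRestrictNormalHom (W.divisionField p))))) : W.divisionField p)) →
            τ • P = a • P →
          ∀ (I J : (Ideal (𝓞 ↥(fixedField ((MulAction.stabilizer (absoluteGaloisGroup ℚ) P).map
              (absRestrictNormalHom (W.divisionField p))))))⁰),
            (J : Ideal (𝓞 ↥(fixedField ((MulAction.stabilizer (absoluteGaloisGroup ℚ) P).map
                (absRestrictNormalHom (W.divisionField p)))))) =
              (I : Ideal (𝓞 ↥(fixedField ((MulAction.stabilizer (absoluteGaloisGroup ℚ) P).map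
                (absRestrictNormalHom (W.divisionField p)))))).map
                (AmbiguousClass.intAut σ :
                  𝓞 ↥(fixedField ((MulAction.stabilizer (absoluteGaloisGroup ℚ) P).map (absRestrictNormalHom (W.divisionField p)))) →+*
                  𝓞 ↥(fixedField ((MulAction.stabilizer (absoluteGaloisGroup ℚ) P).map (absRestrictNormalHom (W.divisionField p))))) →
            μ (Additive.ofMul (ClassGroup.mk0 J)) = a • μ (Additive.ofMul (ClassGroup.mk0 I))) →
        μ = 0) :
    ConjAAt W p := by
  haveI : NumberField ↥(W.divisionField p) := NumberField.mk
  intro κ hκ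
  refine CoatesSujatha2005.conjA_of_eigenHom_subfield W hp2 (ClassX7.irr W p hp2 h7)
    (AdditiveBranchIMCGordTwoRankOne.SmallImageDickson.not_dvd_card_aut_divisionField W p (ClassX7.irr W p hp2 h7) hns)
    _ P hP0 ?_ hEig hκ (SmallImageCleanAtP.cleanAtP_of_goodSS W p hp2 h7.1)
  -- `Γ_{ℚ(P)}` fixes `P`
  intro τ hτ
  have hmem : absRestrictNormalHom (W.divisionField p) τ ∈
      (MulAction.stabilizer (absoluteGaloisGroup ℚ) P).map (absRestrictNormalHom (W.divisionField p)) := by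
    rw [← IntermediateField.fixingSubgroup_fixedField
      ((MulAction.stabilizer (absoluteGaloisGroup ℚ) P).map (absRestrictNormalHom (W.divisionField p))),
      IntermediateField.mem_fixingSubgroup_iff]
    intro x hx
    exact hτ ⟨x, hx⟩
  obtain ⟨τ₀, hτ₀, hres⟩ := Subgroup.mem_map.mp hmem
  have h1 : absRestrictNormalHom (W.divisionField p) (τ₀⁻¹ * τ) = 1 := by rw [map_mul, map_inv, hres, inv_mul_cancel]
  have h2 := (W.absRestrictNormalHom_divisionField_eq_one_iff p (τ₀⁻¹ * τ)).mp h1 P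
  rw [mul_smul, inv_smul_eq_iff] at h2
  rw [h2]; exact hτ₀

/-- **(N2) NECESSARY CONDITION, sharper than `p ∣ h(ℚ(P))`: at a domain pair where M's body FAILS, for EVERY non-zero `P ∈ E[p]` there
is a NON-ZERO `χ_P`-eigen additive map `Cl(𝓞_{ℚ(P)}) → ℤ/p`** (mod the three prints of the lever).  A census row with `p ∣ h(ℚ(P))` but
zero `χ_P`-eigenline in `Cl(ℚ(P))/p` is a certified NON-witness. [cite: DeoRaySujatha2023, §3 Thm. 3.9 (b)] [cite: CoatesSujatha2005, §3 Thm. 3.4]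
[cite: KuriharaPollack2007, §3 p. 328] [cite: Matar2020, Thm. 1.1] -/
theorem exists_eigenHom_ne_zero_of_not_oneSignMuZero (W : WeierstrassCurve ℚ) [W.IsElliptic] [W.IsGloballyMinimal]
    [NeZero p] (hKP : kuriharaPollack2007_selmerDual_extension_of_fineDual) (hKo : signedSelmerInf_sub_fineSelmer_of_loc)
    (hMa : matar2020_thm11_selmerDualTorsion_pseudoIso_fineSelmerDual)
    (hp2 : p ≠ 2) (h7 : ClassX7 W p) (hap : W.frobeniusTrace p = 0) (hns : ¬ Surj W p)
    (hM : ¬ ∃ ε : ℤˣ, ∀ (κ : ZpExtension ℚ p) (γ : absoluteGaloisGroup ℚ), κ.IsCyclotomic → κ.IsTopGenerator γ →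
      IsCyclotomicVariable p γ → ∀ (D : SignedSelmerDualData W κ γ ε) (ξ : IwasawaAlgebra p),
        D.charIdeal = Ideal.span {ξ} → mu ξ = 0)
    (P : geomTorsion W (p : ℤ)) (hP0 : P ≠ 0) :
    haveI : NumberField ↥(W.divisionField p) := NumberField.mk
    ∃ μ : Additive (ClassGroup (𝓞 ↥(fixedField ((MulAction.stabilizer (absoluteGaloisGroup ℚ) P).map
        (absRestrictNormalHom (W.divisionField p)))))) →+ ZMod p,
      μ ≠ 0 ∧
      ∀ (τ : absoluteGaloisGroup ℚ)
          (σ : ↥(fixedField ((MulAction.stabilizer (absoluteGaloisGroup ℚ) P).map (absRestrictNormalHom (W.divisionField p))))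
            ≃ₐ[ℚ] ↥(fixedField ((MulAction.stabilizer (absoluteGaloisGroup ℚ) P).map (absRestrictNormalHom (W.divisionField p)))))
          (a : ℕ),
        (∀ x : ↥(fixedField ((MulAction.stabilizer (absoluteGaloisGroup ℚ) P).map (absRestrictNormalHom (W.divisionField p)))),
            absRestrictNormalHom (W.divisionField p) τ (x : W.divisionField p) =
              ((σ x : ↥(fixedField ((MulAction.stabilizer (absoluteGaloisGroup ℚ) P).map
                (absRestrictNormalHom (W.divisionField p))))) : W.divisionField p)) →
          τ • P = a • P →
        ∀ (I J : (Ideal (𝓞 ↥(fixedField ((MulAction.stabilizer (absoluteGaloisGroup ℚ) P).map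
            (absRestrictNormalHom (W.divisionField p))))))⁰),
          (J : Ideal (𝓞 ↥(fixedField ((MulAction.stabilizer (absoluteGaloisGroup ℚ) P).map
              (absRestrictNormalHom (W.divisionField p)))))) =
            (I : Ideal (𝓞 ↥(fixedField ((MulAction.stabilizer (absoluteGaloisGroup ℚ) P).map
              (absRestrictNormalHom (W.divisionField p)))))).map
              (AmbiguousClass.intAut σ :
                𝓞 ↥(fixedField ((MulAction.stabilizer (absoluteGaloisGroup ℚ) P).map (absRestrictNormalHom (W.divisionField p)))) →+*
                𝓞 ↥(fixedField ((MulAction.stabilizer (absoluteGaloisGroup ℚ) P).map (absRestrictNormalHom (W.divisionField p))))) →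
          μ (Additive.ofMul (ClassGroup.mk0 J)) = a • μ (Additive.ofMul (ClassGroup.mk0 I)) := by
  haveI : NumberField ↥(W.divisionField p) := NumberField.mk
  by_contra hne
  push Not at hne
  exact not_conjAAt_of_not_oneSignMuZero hKP hKo hMa W hp2 h7.1.1 hap hM
    (conjAAt_of_eigenHom_stabilizerField W hp2 h7 hns P hP0 fun μ hμ ↦ by
      by_contra hμ0
      obtain ⟨τ, σ, a, hτσ, hτP, I, J, hIJ, hne'⟩ := hne μ hμ0
      exact hne' (hμ τ σ a hτσ hτP I J hIJ))

/-- **(N3) A failing pair violates IWASAWA's `μ = 0` conjecture**: at a domain pair where M's body FAILS, for every `σ ∈ Γ_ℚ` fixing a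
non-zero `P ∈ E[p]` the cyclotomic `ℤ_p`-extension of the number field `ℚ(E[p])^{⟨σ̄⟩}` has NON-vanishing classical `μ`-invariant
(growth form `IwasawaTheory.ClassicalMuVanishes`), modulo the three prints of the lever.  `σ = 1`: the field is `ℚ(E[p])` (Coates–Sujatha
Thm. 3.4); `σ̄` a generator of `Stab(P)`: the field is `ℚ(P)`, of degree `p² − 1` on the census rows.  Composition of LEAD's lever with
the conjA-anchor's `conjA_rat_of_exists_classicalMuVanishes_fixedField_zpowers` (tameness by Serre's Prop. 15, `ClassX7.irr`).
[cite: CoatesSujatha2005, §3 Thm. 3.4 and Lemma 3.8] [cite: DeoRaySujatha2023, §3 Thm. 3.9 (b), §5 Lemma 5.1] [cite: Iwasawa1973, §1]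
[cite: KuriharaPollack2007, §3 p. 328] [cite: Matar2020, Thm. 1.1] -/
theorem exists_not_classicalMuVanishes_of_not_oneSignMuZero (W : WeierstrassCurve ℚ) [W.IsElliptic]
    [W.IsGloballyMinimal] [NeZero p]
    (hKP : kuriharaPollack2007_selmerDual_extension_of_fineDual) (hKo : signedSelmerInf_sub_fineSelmer_of_loc)
    (hMa : matar2020_thm11_selmerDualTorsion_pseudoIso_fineSelmerDual)
    (hp2 : p ≠ 2) (h7 : ClassX7 W p) (hap : W.frobeniusTrace p = 0) (hns : ¬ Surj W p)
    (hM : ¬ ∃ ε : ℤˣ, ∀ (κ : ZpExtension ℚ p) (γ : absoluteGaloisGroup ℚ), κ.IsCyclotomic → κ.IsTopGenerator γ →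
      IsCyclotomicVariable p γ → ∀ (D : SignedSelmerDualData W κ γ ε) (ξ : IwasawaAlgebra p),
        D.charIdeal = Ideal.span {ξ} → mu ξ = 0)
    (σ : absoluteGaloisGroup ℚ) (P : geomTorsion W (p : ℤ)) (hP0 : P ≠ 0) (hσP : σ • P = P) :
    haveI : NumberField ↥(W.divisionField p) := NumberField.mk
    ∃ κL : ZpExtension ↥(fixedField (Subgroup.zpowers (absRestrictNormalHom (W.divisionField p) σ))) p,
      κL.IsCyclotomic ∧ ¬ ClassicalMuVanishes κL := by
  haveI : NumberField ↥(W.divisionField p) := NumberField.mk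
  by_contra hne
  push Not at hne
  refine not_conjAAt_of_not_oneSignMuZero hKP hKo hMa W hp2 h7.1.1 hap hM ?_
  intro κ hκ
  have hirr := ClassX7.irr W p hp2 h7
  exact CoatesSujatha2005.conjA_rat_of_exists_classicalMuVanishes_fixedField_zpowers W hp2 hirr
    (AdditiveBranchIMCGordTwoRankOne.SmallImageDickson.not_dvd_card_aut_divisionField W p hirr hns)
    ⟨σ, P, hP0, hσP, hne⟩ κ hκ

/-- **`¬M ⟹` Iwasawa's `μ = 0` conjecture fails for some number field** (namely `ℚ(E[p])` at a failing pair), modulo the three prints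
of the lever: the honest price tag of a kill of crux M. [cite: CoatesSujatha2005, §3 Thm. 3.4] [cite: Iwasawa1973, §1]
[cite: KuriharaPollack2007, §3 p. 328] [cite: Matar2020, Thm. 1.1] -/
theorem not_smallImageMuZeroOneSign_imp_iwasawaMu_fails
    (hKP : kuriharaPollack2007_selmerDual_extension_of_fineDual) (hKo : signedSelmerInf_sub_fineSelmer_of_loc)
    (hMa : matar2020_thm11_selmerDualTorsion_pseudoIso_fineSelmerDual)
    (hM : ¬ Theses.SignedLowerHalves.SmallImageMuZeroOneSign) :
    ∃ (W : WeierstrassCurve ℚ) (_ : W.IsElliptic) (p : ℕ) (_ : Fact p.Prime) (_ : NeZero p),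
      haveI : NumberField ↥(W.divisionField p) := NumberField.mk
      ∃ κL : ZpExtension ↥(fixedField (Subgroup.zpowers
          (absRestrictNormalHom (W.divisionField p) (1 : absoluteGaloisGroup ℚ)))) p,
        κL.IsCyclotomic ∧ ¬ ClassicalMuVanishes κL := by
  have hM' : ∃ (W : WeierstrassCurve ℚ) (_ : W.IsElliptic) (_ : W.IsGloballyMinimal) (p : ℕ) (_ : Fact p.Prime),
      p ≠ 2 ∧ ClassX7 W p ∧ ¬ W.HasCM ∧ W.frobeniusTrace p = 0 ∧ ¬ Surj W p ∧
      ¬ ∃ ε : ℤˣ, ∀ (κ : ZpExtension ℚ p) (γ : absoluteGaloisGroup ℚ), κ.IsCyclotomic → κ.IsTopGenerator γ →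
        IsCyclotomicVariable p γ → ∀ (D : SignedSelmerDualData W κ γ ε) (ξ : IwasawaAlgebra p),
          D.charIdeal = Ideal.span {ξ} → mu ξ = 0 := by
    by_contra hne
    apply hM
    intro W _ _ p _ hp h7 hcm hap hs
    by_contra hb
    exact hne ⟨W, ‹_›, ‹_›, p, ‹_›, hp, h7, hcm, hap, hs, hb⟩
  obtain ⟨W, hWe, hWm, p, hpr, hp, h7, hcm, hap, hs, hb⟩ := hM'
  haveI : NeZero p := ⟨hpr.out.ne_zero⟩
  obtain ⟨P, hP0⟩ : ∃ P : geomTorsion W (p : ℤ), P ≠ 0 := W.exists_ne_zero_geomTorsion_prime hpr.out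
  exact ⟨W, hWe, p, hpr, inferInstance,
    exists_not_classicalMuVanishes_of_not_oneSignMuZero W hKP hKo hMa hp h7 hap hs hb 1 P hP0 (one_smul _ _)⟩

end Price

end Summit.BirchSwinnertonDyer.BirchSwinnertonDyer.Theorems.SmallImageMuZeroOneSignNegative

end
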